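import Summits.CriticalPhenomena.PercolationContinuityZ3.Theorems.PercNearOneGluingNoHeavyLowerTailTwoClusterDeficitBound
import Literature.Probability.Percolation.TwoSetExchange
import HarnessLib

/-!
# `NoHeavyLowerTail` (stmt-CriticalPhenomena-4575) — the two-sided BHK inequality with vertex SETS `S, T`

Support file (prover prim-facecert gen 13; `--supports stmt-CriticalPhenomena-4575`).  No definitions, no named
facts, no sorries.  The set form of `twoClusterDeficit_le` / `twoClusterSandwich`
(`…TwoClusterDeficitBound.lean`): for bond percolation `μ = prodBernoulli w` on a finite vertex type, vertex sets
`S, T`, `D = {S ↮ T}`, `C_S = ⋃_{s ∈ S} C_s`, `C_T = ⋃_{t ∈ T} C_t`, `A` increasing in and determined by `C_S`,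
`B` increasing in and determined by `C_T`,

  `μ(D∩A)·μ(D∩B) − μ(D)·μ(D∩A∩B) ≤ μ(Dᶜ∩A∩B) · μ(D∩Aᶜ∩Bᶜ)`      (`setTwoClusterDeficit_le`),
  `μ(D∩A∩Bᶜ) · μ(D∩Aᶜ∩B) ≤ μ(A∩B) · μ(D∩Aᶜ∩Bᶜ)`                  (`setTwoClusterSandwich`).

Proof: van den Berg–Häggström–Kahn's reduction of sets to single vertices (Remark 1 after Thm. 1.2), in the
tree's hub construction (`TwoSetConditionalAssociation`: two hub vertices `s* = inr true`, `t* = inr false` on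
`V ⊕ Bool` joined to `S`, `T` by weight-one edges; the law of the hub model is the image of `μ`,
`measureReal_hub`).  The point checked here is that the reduction is LOSSLESS also on `{S ↔ T}` (where the
one-vertex theorem has the term `μ(Dᶜ ∩ A ∩ B)`): with the hubified event
`A* = {ω' | ∃ ω₀ ∈ A, C_S ω₀ ⊆ (C_{s*} ω' read on the old pairs)}` one has `hubConfig ⁻¹' A* = A` on the WHOLE
space (`hub_preimage_eq`), because `C_S ω₀ ⊆ ω` already forces `C_S ω₀ ⊆ C_S ω`
(`TwoSetExchange.openEdgeCluster_subset_of_subset`).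
-/

noncomputable section

namespace Summit.CriticalPhenomena.PercolationContinuityZ3.Theorems

namespace TwoClusterDeficit

open MeasureTheory Set
open Literature.Probability.LatticeModels (prodBernoulli)
open Literature.Probability.Percolation
open Literature.Probability.Percolation.TwoSetConditionalAssociation

variable {V : Type*}

/-- `C_S ω` (read through `inl`) lies in the hub's cluster `C_{inr b}` of the augmented configuration, on the
whole space (no separation hypothesis; compare `restrictConfig_openEdgeCluster_hub`). [folklore] -/
theorem biUnion_openEdgeCluster_subset_hub (side : Bool → Set V) (ω : BondConfig V) (b : Bool) :
    (⋃ s ∈ side b, openEdgeCluster ω s) ⊆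
      restrictConfig Sum.inl (openEdgeCluster (hubConfig side ω) (Sum.inr b)) := by
  intro e he
  rw [mem_biUnion_openEdgeCluster_iff] at he
  obtain ⟨heω, hdiag, hall⟩ := he
  rw [mem_restrictConfig, mem_openEdgeCluster_iff, map_inl_mem_hubConfig_iff,
    Sym2.isDiag_map Sum.inl_injective]
  refine ⟨heω, hdiag, fun v' hv' => ?_⟩
  obtain ⟨v, hv, rfl⟩ := Sym2.mem_map.1 hv'
  obtain ⟨s, hs, hsv⟩ := hall v hv
  exact hubConfig_reachable_hub_inl side ω hs hsv

/-- **The hub reduction is lossless for cluster-monotone events**: for `A` increasing in and determined by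
`C_{side b}`, the hubified event `{ω' | ∃ ω₀ ∈ A, C_{side b} ω₀ ⊆ C_{inr b} ω' read on the old pairs}` pulls
back to `A` under `hubConfig` (on the whole space). [this work] -/
theorem hub_preimage_eq (side : Bool → Set V) (b : Bool) {A : Set (BondConfig V)}
    (hA : ∀ ⦃ω ω' : BondConfig V⦄, ω ∈ A → (⋃ s ∈ side b, openEdgeCluster ω s) ⊆
      (⋃ s ∈ side b, openEdgeCluster ω' s) → ω' ∈ A) :
    hubConfig side ⁻¹' {ω' : BondConfig (V ⊕ Bool) | ∃ ω₀ ∈ A, (⋃ s ∈ side b, openEdgeCluster ω₀ s) ⊆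
        restrictConfig Sum.inl (openEdgeCluster ω' (Sum.inr b))} = A := by
  ext ω
  simp only [mem_preimage, mem_setOf_eq]
  constructor
  · rintro ⟨ω₀, hω₀, hsub⟩
    have h1 : (⋃ s ∈ side b, openEdgeCluster ω₀ s) ⊆ ω := fun e he => by
      have h2 := hsub he
      rw [mem_restrictConfig] at h2
      exact (map_inl_mem_hubConfig_iff side ω e).1 (openEdgeCluster_subset _ _ h2)
    refine hA hω₀ fun e he => ?_
    obtain ⟨s, hs, hes⟩ := Set.mem_iUnion₂.1 he
    exact Set.mem_biUnion hs (TwoSetExchange.openEdgeCluster_subset_of_subset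
      (fun e' he' => h1 (Set.mem_biUnion hs he')) hes)
  · intro hω
    exact ⟨ω, hω, biUnion_openEdgeCluster_subset_hub side ω b⟩

end TwoClusterDeficit

variable {V : Type*} [Fintype V]

open MeasureTheory Set
open Literature.Probability.LatticeModels (prodBernoulli)
open Literature.Probability.Percolation
open Literature.Probability.Percolation.TwoSetConditionalAssociation
open TwoClusterDeficit

/-- **Two-sided BHK inequality with vertex sets.**  `μ = prodBernoulli w` on a finite vertex type, `S, T` sets
of vertices, `D = {S ↮ T}`; `A` increasing in and determined by `C_S = ⋃_{s∈S} C_s`, `B` increasing in and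
determined by `C_T`.  Then `μ(D∩A)·μ(D∩B) − μ(D)·μ(D∩A∩B) ≤ μ(Dᶜ∩A∩B)·μ(D∩Aᶜ∩Bᶜ)`.  [this work] -/
theorem setTwoClusterDeficit_le (w : Sym2 V → unitInterval) (S T : Set V) {A B : Set (BondConfig V)}
    (hA : ∀ ⦃ω ω' : BondConfig V⦄, ω ∈ A → (⋃ s ∈ S, openEdgeCluster ω s) ⊆
      (⋃ s ∈ S, openEdgeCluster ω' s) → ω' ∈ A)
    (hB : ∀ ⦃ω ω' : BondConfig V⦄, ω ∈ B → (⋃ t ∈ T, openEdgeCluster ω t) ⊆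
      (⋃ t ∈ T, openEdgeCluster ω' t) → ω' ∈ B) :
    (prodBernoulli w).real ({ω : BondConfig V | ∀ s ∈ S, ∀ t ∈ T, ¬ (openGraph ω).Reachable s t} ∩ A) *
        (prodBernoulli w).real ({ω : BondConfig V | ∀ s ∈ S, ∀ t ∈ T, ¬ (openGraph ω).Reachable s t} ∩ B) -
      (prodBernoulli w).real {ω : BondConfig V | ∀ s ∈ S, ∀ t ∈ T, ¬ (openGraph ω).Reachable s t} *
        (prodBernoulli w).real
          ({ω : BondConfig V | ∀ s ∈ S, ∀ t ∈ T, ¬ (openGraph ω).Reachable s t} ∩ A ∩ B) ≤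
    (prodBernoulli w).real ({ω : BondConfig V | ∀ s ∈ S, ∀ t ∈ T, ¬ (openGraph ω).Reachable s t}ᶜ ∩ A ∩ B) *
      (prodBernoulli w).real
        ({ω : BondConfig V | ∀ s ∈ S, ∀ t ∈ T, ¬ (openGraph ω).Reachable s t} ∩ Aᶜ ∩ Bᶜ) := by
  classical
  -- hubified events on `V ⊕ Bool`
  set A' : Set (BondConfig (V ⊕ Bool)) := {ω' | ∃ ω₀ ∈ A, (⋃ s ∈ sides S T true, openEdgeCluster ω₀ s) ⊆
    restrictConfig Sum.inl (openEdgeCluster ω' (Sum.inr true))} with hA'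
  set B' : Set (BondConfig (V ⊕ Bool)) := {ω' | ∃ ω₀ ∈ B, (⋃ t ∈ sides S T false, openEdgeCluster ω₀ t) ⊆
    restrictConfig Sum.inl (openEdgeCluster ω' (Sum.inr false))} with hB'
  have hA'm : ∀ ⦃ω' ω'' : BondConfig (V ⊕ Bool)⦄, ω' ∈ A' →
      openEdgeCluster ω' (Sum.inr true) ⊆ openEdgeCluster ω'' (Sum.inr true) → ω'' ∈ A' := by
    rintro ω' ω'' ⟨ω₀, hω₀, hsub⟩ hle
    exact ⟨ω₀, hω₀, hsub.trans (restrictConfig_mono' Sum.inl hle)⟩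
  have hB'm : ∀ ⦃ω' ω'' : BondConfig (V ⊕ Bool)⦄, ω' ∈ B' →
      openEdgeCluster ω' (Sum.inr false) ⊆ openEdgeCluster ω'' (Sum.inr false) → ω'' ∈ B' := by
    rintro ω' ω'' ⟨ω₀, hω₀, hsub⟩ hle
    exact ⟨ω₀, hω₀, hsub.trans (restrictConfig_mono' Sum.inl hle)⟩
  have hpA : hubConfig (sides S T) ⁻¹' A' = A := hub_preimage_eq (sides S T) true (by simpa using hA)
  have hpB : hubConfig (sides S T) ⁻¹' B' = B := hub_preimage_eq (sides S T) false (by simpa using hB)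
  have key := twoClusterDeficit_le (hubWeight w (sides S T)) (Sum.inr true) (Sum.inr false) hA'm hB'm
  simp only [measureReal_hub, Set.preimage_inter, Set.preimage_compl, hubConfig_preimage_not_reachable,
    sides_true, sides_false, hpA, hpB] at key
  exact key

/-- **The BHK sandwich with vertex sets, upper half, `2 × 2` form**:
`μ(D∩A∩Bᶜ)·μ(D∩Aᶜ∩B) ≤ μ(A∩B)·μ(D∩Aᶜ∩Bᶜ)`, `D = {S ↮ T}`.  [this work] -/
theorem setTwoClusterSandwich (w : Sym2 V → unitInterval) (S T : Set V) {A B : Set (BondConfig V)}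
    (hA : ∀ ⦃ω ω' : BondConfig V⦄, ω ∈ A → (⋃ s ∈ S, openEdgeCluster ω s) ⊆
      (⋃ s ∈ S, openEdgeCluster ω' s) → ω' ∈ A)
    (hB : ∀ ⦃ω ω' : BondConfig V⦄, ω ∈ B → (⋃ t ∈ T, openEdgeCluster ω t) ⊆
      (⋃ t ∈ T, openEdgeCluster ω' t) → ω' ∈ B) :
    (prodBernoulli w).real
          ({ω : BondConfig V | ∀ s ∈ S, ∀ t ∈ T, ¬ (openGraph ω).Reachable s t} ∩ A ∩ Bᶜ) *
        (prodBernoulli w).real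
          ({ω : BondConfig V | ∀ s ∈ S, ∀ t ∈ T, ¬ (openGraph ω).Reachable s t} ∩ Aᶜ ∩ B) ≤
      (prodBernoulli w).real (A ∩ B) *
        (prodBernoulli w).real
          ({ω : BondConfig V | ∀ s ∈ S, ∀ t ∈ T, ¬ (openGraph ω).Reachable s t} ∩ Aᶜ ∩ Bᶜ) := by
  classical
  set A' : Set (BondConfig (V ⊕ Bool)) := {ω' | ∃ ω₀ ∈ A, (⋃ s ∈ sides S T true, openEdgeCluster ω₀ s) ⊆
    restrictConfig Sum.inl (openEdgeCluster ω' (Sum.inr true))} with hA'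
  set B' : Set (BondConfig (V ⊕ Bool)) := {ω' | ∃ ω₀ ∈ B, (⋃ t ∈ sides S T false, openEdgeCluster ω₀ t) ⊆
    restrictConfig Sum.inl (openEdgeCluster ω' (Sum.inr false))} with hB'
  have hA'm : ∀ ⦃ω' ω'' : BondConfig (V ⊕ Bool)⦄, ω' ∈ A' →
      openEdgeCluster ω' (Sum.inr true) ⊆ openEdgeCluster ω'' (Sum.inr true) → ω'' ∈ A' := by
    rintro ω' ω'' ⟨ω₀, hω₀, hsub⟩ hle
    exact ⟨ω₀, hω₀, hsub.trans (restrictConfig_mono' Sum.inl hle)⟩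
  have hB'm : ∀ ⦃ω' ω'' : BondConfig (V ⊕ Bool)⦄, ω' ∈ B' →
      openEdgeCluster ω' (Sum.inr false) ⊆ openEdgeCluster ω'' (Sum.inr false) → ω'' ∈ B' := by
    rintro ω' ω'' ⟨ω₀, hω₀, hsub⟩ hle
    exact ⟨ω₀, hω₀, hsub.trans (restrictConfig_mono' Sum.inl hle)⟩
  have hpA : hubConfig (sides S T) ⁻¹' A' = A := hub_preimage_eq (sides S T) true (by simpa using hA)
  have hpB : hubConfig (sides S T) ⁻¹' B' = B := hub_preimage_eq (sides S T) false (by simpa using hB)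
  have key := twoClusterSandwich (hubWeight w (sides S T)) (Sum.inr true) (Sum.inr false) hA'm hB'm
  simp only [measureReal_hub, Set.preimage_inter, Set.preimage_compl, hubConfig_preimage_not_reachable,
    sides_true, sides_false, hpA, hpB] at key
  exact key

end Summit.CriticalPhenomena.PercolationContinuityZ3.Theorems
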